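import Mathlib.Analysis.SpecialFunctions.Trigonometric.Chebyshev.Basic
import Mathlib.Analysis.Complex.OpenMapping
import Mathlib.Analysis.Complex.RemovableSingularity
import Mathlib.Analysis.Calculus.InverseFunctionTheorem.Deriv
import Literature.Analysis.Complex.SeparatelyHolomorphicStrips
import Literature.MathematicalPhysics.QuantumFieldTheory.MullerSchiemann1987.MS87CentralAngle
import HarnessLib

/-!
# Müller–Schiemann, *Continuum limit of a hierarchical SU(2) lattice gauge theory in 4 dimensions*
# (CMP 110, 1987), FROM THE PROOF OF THEOREM 3 (pp.282–283): the strip-to-ellipse map `w = cos z`,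
# the factorisation `h(z) = H(cos z)` of (6.20) WITH `H` HOLOMORPHIC ON THE ELLIPSE `𝒟` (v1.1), and the continuation
# `g̃(u, z) = H(u₀ cos z + u₃ sin z)` of (6.21) — PROVED (theorems only; no definition, no named fact)

statement-level skeleton of published theorems with citation tags; proofs where landed; nothing here is a claim about the Yang–Mills mass gap

**Citation header (reproduction of PUBLISHED work).** V. F. Müller, J. Schiemann, *Continuum limit of a hierarchical
SU(2) lattice gauge theory in 4 dimensions*, Commun. Math. Phys. **110** (1987) 261–286, doi 10.1007/BF01207367
[MullerSchiemann1987]; (2.7)–(2.12), (2.17) pp.264–265, Theorem 3 and (6.19)–(6.20) p.282, (6.21)–(6.22) p.283 (held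
Project Euclid scan `paper:url-96df5da18d4c`; displays read by this seat on its own 3× page renders
`run/shared/lean/pub/lit-balaban/lit-balaban-p12/renders-cmp110ms/ms87-cmp110-pdfp022,023-journalp282,283-x3.png`).
Lean lane of the lit-balaban YM LIT SWEEP CONTEXT row X1 (register level; zero weight for any token of that table); the
model is the `d = 4` HIERARCHICAL `SU(2)` gauge model, NOT lattice Yang–Mills.

**What the paper prints (proof of Theorem 3, p.282 L.29 – p.283 L.6).** *«Consider first an arbitrary convergent
subsequence of (h_N^{(−n)})_{N≥n} at a given scale n; i.e. assume lim_{j→∞} h_{N_j}^{(−n)}(z) = h^{(−n)}(z). (6.19) The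
convergence is locally uniform, and thus h^{(−n)}(z) holomorphic, in |Im z| < d_n := (κ/2)(β^{(−n)})^{−α} due to the
uniform bound (6.18). Part 1) of Theorem 2 implies that h^{(−n)} is even, 2π-periodic and nonnegative for real
arguments. Furthermore, the Fourier expansion Σ_{m=0}^{∞} a_m^{(−n)} cos(mz) of h^{(−n)}(z) is uniformly convergent in
|Im z| ≤ d′ < d_n. Since cos mz is a polynomial in w = cos z, this series defines a holomorphic function H^{(−n)}(w) on
𝒟_n := {w = w₁ + iw₂ ∈ ℂ : w₁²/cosh²d_n + w₂²/sinh²d_n < 1}, the image of {|Im z| < d_n} under w = cos z, satisfying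
there h^{(−n)}(z) = H^{(−n)}(cos z). (6.20) Thus we can define, for u ∈ G and z ∈ ℂ, |Im z| < d_n, implying
u₀ cos z + u₃ sin z ∈ 𝒟_n, g̃^{(−n)}(u, z) = H^{(−n)}(u₀ cos z + u₃ sin z), (6.21) which is clearly continuous in u ∈ G
and holomorphic in z, satisfying (2.8)–(2.10). Equation (6.21) is the unique "analytic continuation," (2.7), of
g^{(−n)}(u) := g̃^{(−n)}(u, 0) = H^{(−n)}(u₀) …»*; (2.8) `g̃(e^{−ix′σ₃}u, z) = g̃(u, x′ + z)`, (2.9)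
`g̃(u, z) = g̃(u⁻¹, −z)`, (2.10) `h(z) := g̃(e₀, z)`, (2.11)–(2.12) `h` is `2π`-periodic and even (p.264).

**What this file proves (kernel-checked, 0 sorry, standard axioms; no definition, no named fact).** Throughout
`𝒟(d) = {w : (Re w)²/cosh²d + (Im w)²/sinh²d < 1}` is written out, and `u₀, u₃, e^{−ixσ₃}` are the sibling
`MS87HeatKernelGroup`'s `u0`, `u3`, `diagPhase`.
* §1 the real/imaginary parts of `u₀ cos z + u₃ sin z` (`inner_eq`) and the value of the quadratic form of `𝒟(d)` on it
  (`inner_form_eq`, `cos_form_eq`).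
* §2 **«𝒟_n, the image of {|Im z| < d_n} under w = cos z»** and **«|Im z| < d_n, implying u₀ cos z + u₃ sin z ∈ 𝒟_n»**:
  `inner_mem_ellipse` (any real `u₀, u₃` with `u₀² + u₃² ≤ 1`), `cos_mem_ellipse`, the converse
  `abs_im_lt_of_cos_mem_ellipse`, and the set identity **`cos '' {|Im z| < d} = 𝒟(d)`** (`cos_image_strip`, `d > 0`,
  with `Complex.cos_surjective`).
* §3 the set-theoretic core of **(6.20)**: an even `2π`-periodic `h : ℂ → ℂ` takes equal values at points with equal
  cosine (`eq_of_cos_eq`, from `Complex.cos_eq_cos_iff`), hence `h = H ∘ cos` for some `H : ℂ → ℂ`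
  (`exists_factor_cos`), unique (`factor_cos_unique`); conversely `H ∘ cos` is even and `2π`-periodic; and the
  mechanism «cos mz is a polynomial in w = cos z»: a partial Fourier sum `Σ_{m<M} a_m cos(mz)` is the Chebyshev
  polynomial `Σ a_m T_m` evaluated at `cos z` (`fourierPartialSum_eq_chebyshev_eval`, Mathlib's `T_complex_cos`).
* §4 **(6.21) for an ARBITRARY `H : ℂ → ℂ`**: `g̃_H(u, z) := H(u₀ cos z + u₃ sin z)` satisfies **(2.8)**
  (`eq621_symm28`, from `u₀(e^{−ixσ₃}u) cos z + u₃(e^{−ixσ₃}u) sin z = u₀ cos(x + z) + u₃ sin(x + z)`,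
  `inner_diagPhase_mul`), **(2.9)** (`eq621_symm29`), **(2.10)** `g̃_H(e₀, z) = H(cos z)` (`eq621_at_one`),
  `g̃_H(u, 0) = H(u₀)` (`eq621_at_zero`), and is holomorphic in `z` on `{|Im z| < d}` / jointly continuous on
  `G × {|Im z| < d}` as soon as `H` is holomorphic / continuous on `𝒟(d)` (`differentiableOn_eq621`,
  `continuousOn_eq621`).
* §5 (v1.1) **the ANALYTIC content of (6.20): `H` is HOLOMORPHIC on `𝒟(d)`** whenever `h = H ∘ cos` is holomorphic on
  the strip `{|Im z| < d}`, `d > 0` (`differentiableOn_factor`; continuity `continuousOn_factor`), hence **(6.20)**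
  `eq620` (even, `2π`-periodic, holomorphic-on-the-strip `h` ⟹ `h = H ∘ cos` with `H` holomorphic on `𝒟(d)`) and the
  assembled **(6.20)–(6.21)** `eq621` (such `H` exists, `g̃_H(u, ·)` is holomorphic on the strip for every `u ∈ G`, and
  `g̃_H(e₀, z) = h(z)`). Route (declared deviation from the printed Fourier–Chebyshev argument, same conclusion):
  `cos` is an open map (`isOpenMap_cos`, Mathlib's open mapping theorem) ⟹ `H` continuous; at non-critical values
  `w = cos z₀`, `sin z₀ ≠ 0`, `H = h ∘ cos⁻¹_loc` (`differentiableAt_factor`, Mathlib's `HasStrictDerivAt.localInverse`);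
  the critical values `±1` (`cos_eq_one_or_neg_one_of_sin_eq_zero`) are removable singularities (Mathlib's
  `Complex.differentiableOn_compl_singleton_and_continuousAt_iff`).
* §6 (v1.1) **«(6.21) is the unique "analytic continuation," (2.7), of g(u) := g̃(u, 0) = H(u₀)»** (`eq621_unique`): a
  family `G̃(u, ·)` holomorphic on the strip with the symmetry (2.8) and `G̃(u, 0) = H(u₀)` equals
  `H(u₀ cos z + u₃ sin z)` on the strip (real `x`: (2.8) at `z = 0` and (2.17); then the identity theorem on the
  strip from the real axis, the tree's `Literature.Analysis.Complex.eqOn_setOf_abs_im_lt_of_forall_ofReal`; the strip's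
  openness is the tree's `isOpen_setOf_abs_im_lt`).

**Readings / scope (declared).** (i) v1.0 left the analytic content of (6.20) (holomorphy of `H^{(−n)}` on `𝒟_n`)
unformalized; §5 (v1.1) PROVES it, by the classical route named above rather than through the uniformly convergent
Fourier–Chebyshev series of the text (§3 keeps the Chebyshev mechanism for partial sums). The limit (6.19), the
normal-family input (6.18), (6.22) and Theorem 3 itself are NOT formalized here. (ii) §4 is model-free: it is stated for
any `H`, which is how (6.21) uses it; `eq621` instantiates it with the holomorphic `H` of `eq620`.

**Not claimed.** Theorem 3; (6.19), (6.22); properties (i)–(ii) of `𝒯` (p.283); anything about lattice Yang–Mills or the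
Clay problem.
-/

open Complex

namespace Literature.MathematicalPhysics.QuantumFieldTheory

namespace MullerSchiemann1987

namespace Theorem3Continuation

/-! ## §1 Real and imaginary parts of `u₀ cos z + u₃ sin z` -/

/-- `u₀ cos z + u₃ sin z = (u₀ cos x + u₃ sin x) cosh t + i (u₃ cos x − u₀ sin x) sinh t` for `z = x + it`.
[cite: MullerSchiemann1987, Remark p.265; p.283 L.1] -/
theorem inner_eq (u₀ u₃ : ℝ) (z : ℂ) :
    (u₀ : ℂ) * Complex.cos z + u₃ * Complex.sin z =
      (((u₀ * Real.cos z.re + u₃ * Real.sin z.re) * Real.cosh z.im : ℝ) : ℂ) +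
        (((u₃ * Real.cos z.re - u₀ * Real.sin z.re) * Real.sinh z.im : ℝ) : ℂ) * I := by
  rw [Complex.cos_eq z, Complex.sin_eq z]
  push_cast
  ring

/-- Real part of `u₀ cos z + u₃ sin z`. [cite: MullerSchiemann1987, Remark p.265; p.283 L.1] -/
theorem inner_re (u₀ u₃ : ℝ) (z : ℂ) :
    ((u₀ : ℂ) * Complex.cos z + u₃ * Complex.sin z).re =
      (u₀ * Real.cos z.re + u₃ * Real.sin z.re) * Real.cosh z.im := by
  rw [inner_eq]
  simp only [Complex.add_re, Complex.mul_re, Complex.ofReal_re, Complex.ofReal_im, Complex.I_re, Complex.I_im,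
    mul_zero, zero_mul, sub_zero, add_zero]

/-- Imaginary part of `u₀ cos z + u₃ sin z`. [cite: MullerSchiemann1987, Remark p.265; p.283 L.1] -/
theorem inner_im (u₀ u₃ : ℝ) (z : ℂ) :
    ((u₀ : ℂ) * Complex.cos z + u₃ * Complex.sin z).im =
      (u₃ * Real.cos z.re - u₀ * Real.sin z.re) * Real.sinh z.im := by
  rw [inner_eq]
  simp only [Complex.add_im, Complex.mul_im, Complex.ofReal_re, Complex.ofReal_im, Complex.I_re, Complex.I_im,
    mul_zero, mul_one, zero_add, add_zero]

/-- The quadratic form of the ellipse `𝒟(d)` on `u₀ cos z + u₃ sin z`, `z = x + it`: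
`P² (cosh²t/cosh²d) + Q² (sinh²t/sinh²d)` with `P = u₀ cos x + u₃ sin x`, `Q = u₃ cos x − u₀ sin x`.
[cite: MullerSchiemann1987, p.282 L.37–38, p.283 L.1] -/
theorem inner_form_eq (u₀ u₃ : ℝ) (z : ℂ) (d : ℝ) :
    ((u₀ : ℂ) * Complex.cos z + u₃ * Complex.sin z).re ^ 2 / Real.cosh d ^ 2 +
        ((u₀ : ℂ) * Complex.cos z + u₃ * Complex.sin z).im ^ 2 / Real.sinh d ^ 2 =
      (u₀ * Real.cos z.re + u₃ * Real.sin z.re) ^ 2 * (Real.cosh z.im ^ 2 / Real.cosh d ^ 2) +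
        (u₃ * Real.cos z.re - u₀ * Real.sin z.re) ^ 2 * (Real.sinh z.im ^ 2 / Real.sinh d ^ 2) := by
  rw [inner_re, inner_im]
  ring

/-- The quadratic form of `𝒟(d)` on `cos z`: `cos²x (cosh²t/cosh²d) + sin²x (sinh²t/sinh²d)`.
[cite: MullerSchiemann1987, p.282 L.37–38] -/
theorem cos_form_eq (z : ℂ) (d : ℝ) :
    (Complex.cos z).re ^ 2 / Real.cosh d ^ 2 + (Complex.cos z).im ^ 2 / Real.sinh d ^ 2 =
      Real.cos z.re ^ 2 * (Real.cosh z.im ^ 2 / Real.cosh d ^ 2) +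
        Real.sin z.re ^ 2 * (Real.sinh z.im ^ 2 / Real.sinh d ^ 2) := by
  have e : Complex.cos z = ((1 : ℝ) : ℂ) * Complex.cos z + ((0 : ℝ) : ℂ) * Complex.sin z := by push_cast; ring
  rw [e, inner_form_eq]
  ring

/-! ## §2 The strip `{|Im z| < d}` and the ellipse `𝒟(d)` under `w = cos z` -/

/-- **«|Im z| < d_n, implying u₀ cos z + u₃ sin z ∈ 𝒟_n»**, for any real `u₀, u₃` with `u₀² + u₃² ≤ 1`.
[cite: MullerSchiemann1987, p.283 L.1] -/
theorem inner_mem_ellipse {u₀ u₃ : ℝ} (hu : u₀ ^ 2 + u₃ ^ 2 ≤ 1) {z : ℂ} {d : ℝ} (hz : |z.im| < d) :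
    ((u₀ : ℂ) * Complex.cos z + u₃ * Complex.sin z).re ^ 2 / Real.cosh d ^ 2 +
        ((u₀ : ℂ) * Complex.cos z + u₃ * Complex.sin z).im ^ 2 / Real.sinh d ^ 2 < 1 := by
  rw [inner_form_eq]
  set x := z.re
  set t := z.im
  set P := u₀ * Real.cos x + u₃ * Real.sin x with hP
  set Q := u₃ * Real.cos x - u₀ * Real.sin x with hQ
  have hPQ : P ^ 2 + Q ^ 2 ≤ 1 := by
    have e : P ^ 2 + Q ^ 2 = (u₀ ^ 2 + u₃ ^ 2) * (Real.cos x ^ 2 + Real.sin x ^ 2) := by rw [hP, hQ]; ring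
    rw [e, Real.cos_sq_add_sin_sq, mul_one]; exact hu
  have hd : 0 < d := lt_of_le_of_lt (abs_nonneg _) hz
  have hC : Real.cosh t < Real.cosh d := Real.cosh_lt_cosh.mpr (by rwa [abs_of_pos hd])
  have hCt : 1 ≤ Real.cosh t := Real.one_le_cosh t
  have hSd : Real.sinh d ^ 2 = Real.cosh d ^ 2 - 1 := Real.sinh_sq d
  have hSt : Real.sinh t ^ 2 = Real.cosh t ^ 2 - 1 := Real.sinh_sq t
  have hCC : Real.cosh t ^ 2 < Real.cosh d ^ 2 := by nlinarith
  have hSd0 : 0 < Real.sinh d ^ 2 := by rw [hSd]; nlinarith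
  have ha : Real.cosh t ^ 2 / Real.cosh d ^ 2 < 1 := (div_lt_one (by positivity)).mpr hCC
  have hb : Real.sinh t ^ 2 / Real.sinh d ^ 2 < 1 := (div_lt_one hSd0).mpr (by rw [hSt, hSd]; linarith)
  have ha0 : 0 ≤ Real.cosh t ^ 2 / Real.cosh d ^ 2 := by positivity
  set a := Real.cosh t ^ 2 / Real.cosh d ^ 2
  set b := Real.sinh t ^ 2 / Real.sinh d ^ 2
  have hm : max a b < 1 := max_lt ha hb
  have h1 : P ^ 2 * a ≤ P ^ 2 * max a b := mul_le_mul_of_nonneg_left (le_max_left a b) (sq_nonneg P)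
  have h2 : Q ^ 2 * b ≤ Q ^ 2 * max a b := mul_le_mul_of_nonneg_left (le_max_right a b) (sq_nonneg Q)
  have h3 : (P ^ 2 + Q ^ 2) * max a b ≤ 1 * max a b :=
    mul_le_mul_of_nonneg_right hPQ (le_trans ha0 (le_max_left a b))
  linarith

/-- `cos z ∈ 𝒟(d)` for `|Im z| < d` (the case `u = e₀`). [cite: MullerSchiemann1987, p.282 L.37–39] -/
theorem cos_mem_ellipse {z : ℂ} {d : ℝ} (hz : |z.im| < d) :
    (Complex.cos z).re ^ 2 / Real.cosh d ^ 2 + (Complex.cos z).im ^ 2 / Real.sinh d ^ 2 < 1 := by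
  have hu : (1 : ℝ) ^ 2 + (0 : ℝ) ^ 2 ≤ 1 := by norm_num
  have h := inner_mem_ellipse hu hz
  have e : ((1 : ℝ) : ℂ) * Complex.cos z + ((0 : ℝ) : ℂ) * Complex.sin z = Complex.cos z := by push_cast; ring
  rwa [e] at h

/-- Conversely, if `cos θ ∈ 𝒟(d)` (`d > 0`) then `|Im θ| < d`: `cos(a + ib)` lies ON the `|b|`-ellipse, which is
outside `𝒟(d)` when `|b| ≥ d`. [cite: MullerSchiemann1987, p.282 L.37–39; Remark p.265] -/
theorem abs_im_lt_of_cos_mem_ellipse {d : ℝ} (hd : 0 < d) {θ : ℂ}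
    (h : (Complex.cos θ).re ^ 2 / Real.cosh d ^ 2 + (Complex.cos θ).im ^ 2 / Real.sinh d ^ 2 < 1) :
    |θ.im| < d := by
  rw [cos_form_eq] at h
  by_contra hle
  push Not at hle
  set a := θ.re
  set b := θ.im
  have hC : Real.cosh d ≤ Real.cosh b := Real.cosh_le_cosh.mpr (by rwa [abs_of_pos hd])
  have hCd : 1 ≤ Real.cosh d := Real.one_le_cosh d
  have hSd : Real.sinh d ^ 2 = Real.cosh d ^ 2 - 1 := Real.sinh_sq d
  have hSb : Real.sinh b ^ 2 = Real.cosh b ^ 2 - 1 := Real.sinh_sq b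
  have hCC : Real.cosh d ^ 2 ≤ Real.cosh b ^ 2 := by nlinarith
  have hSd0 : 0 < Real.sinh d ^ 2 := pow_pos (Real.sinh_pos_iff.mpr hd) 2
  have h1 : 1 ≤ Real.cosh b ^ 2 / Real.cosh d ^ 2 := (one_le_div (by positivity)).mpr hCC
  have h2 : 1 ≤ Real.sinh b ^ 2 / Real.sinh d ^ 2 := (one_le_div hSd0).mpr (by rw [hSb, hSd]; linarith)
  have hcs : Real.cos a ^ 2 + Real.sin a ^ 2 = 1 := Real.cos_sq_add_sin_sq a
  have k1 : Real.cos a ^ 2 * 1 ≤ Real.cos a ^ 2 * (Real.cosh b ^ 2 / Real.cosh d ^ 2) :=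
    mul_le_mul_of_nonneg_left h1 (sq_nonneg _)
  have k2 : Real.sin a ^ 2 * 1 ≤ Real.sin a ^ 2 * (Real.sinh b ^ 2 / Real.sinh d ^ 2) :=
    mul_le_mul_of_nonneg_left h2 (sq_nonneg _)
  linarith

/-- Every point of `𝒟(d)` (`d > 0`) is `cos z` for some `z` in the strip `|Im z| < d` (`cos : ℂ → ℂ` is onto).
[cite: MullerSchiemann1987, p.282 L.37–39] -/
theorem exists_cos_eq_of_mem_ellipse {d : ℝ} (hd : 0 < d) {w : ℂ}
    (hw : w.re ^ 2 / Real.cosh d ^ 2 + w.im ^ 2 / Real.sinh d ^ 2 < 1) :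
    ∃ z : ℂ, |z.im| < d ∧ Complex.cos z = w := by
  obtain ⟨z, rfl⟩ := Complex.cos_surjective w
  exact ⟨z, abs_im_lt_of_cos_mem_ellipse hd hw, rfl⟩

/-- **`𝒟_n` is «the image of {|Im z| < d_n} under w = cos z»**: for `d > 0`,
`cos '' {z : |Im z| < d} = {w : (Re w)²/cosh²d + (Im w)²/sinh²d < 1}`. [cite: MullerSchiemann1987, p.282 L.37–39] -/
theorem cos_image_strip {d : ℝ} (hd : 0 < d) :
    Complex.cos '' {z : ℂ | |z.im| < d} =
      {w : ℂ | w.re ^ 2 / Real.cosh d ^ 2 + w.im ^ 2 / Real.sinh d ^ 2 < 1} := by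
  ext w
  constructor
  · rintro ⟨z, hz, rfl⟩
    exact cos_mem_ellipse hz
  · intro hw
    obtain ⟨z, hz, rfl⟩ := exists_cos_eq_of_mem_ellipse hd hw
    exact ⟨z, hz, rfl⟩

/-! ## §3 (6.20): an even `2π`-periodic `h` is a function of `cos z` -/

/-- An even, `2π`-periodic `h : ℂ → ℂ` takes the same value at `z`, `z′` whenever `cos z = cos z′`
(`z′ = 2kπ ± z`). [cite: MullerSchiemann1987, (2.11)–(2.12) p.264, (6.20) p.282] -/
theorem eq_of_cos_eq {h : ℂ → ℂ} (he : ∀ z, h (-z) = h z) (hp : Function.Periodic h (2 * (Real.pi : ℂ)))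
    {z z' : ℂ} (hc : Complex.cos z = Complex.cos z') : h z = h z' := by
  obtain ⟨k, hk | hk⟩ := Complex.cos_eq_cos_iff.mp hc
  · rw [hk, show (2 : ℂ) * k * Real.pi + z = z + k * (2 * (Real.pi : ℂ)) by ring]
    exact ((hp.int_mul k) z).symm
  · rw [hk, show (2 : ℂ) * k * Real.pi - z = -z + k * (2 * (Real.pi : ℂ)) by ring, (hp.int_mul k) (-z), he]

/-- **(6.20), set-theoretically**: an even, `2π`-periodic `h : ℂ → ℂ` factors as `h(z) = H(cos z)` for some
`H : ℂ → ℂ` (holomorphy of `H` on `𝒟(d)` when `h` is holomorphic on the strip: §5, `differentiableOn_factor`,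
`eq620`). [cite: MullerSchiemann1987, (6.20) p.282] -/
theorem exists_factor_cos {h : ℂ → ℂ} (he : ∀ z, h (-z) = h z) (hp : Function.Periodic h (2 * (Real.pi : ℂ))) :
    ∃ H : ℂ → ℂ, ∀ z, h z = H (Complex.cos z) := by
  refine ⟨fun w => h (Function.surjInv Complex.cos_surjective w), fun z => ?_⟩
  exact eq_of_cos_eq he hp (Function.surjInv_eq Complex.cos_surjective (Complex.cos z)).symm

/-- The factor `H` in `h = H ∘ cos` is unique (on all of `ℂ`, `cos` being onto). [cite: MullerSchiemann1987, (6.20)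
p.282, «(6.21) is the unique "analytic continuation"» p.283] -/
theorem factor_cos_unique {H₁ H₂ : ℂ → ℂ} (hH : ∀ z, H₁ (Complex.cos z) = H₂ (Complex.cos z)) : H₁ = H₂ := by
  funext w
  obtain ⟨z, rfl⟩ := Complex.cos_surjective w
  exact hH z

/-- Conversely `H ∘ cos` is even ((2.12)). [cite: MullerSchiemann1987, (2.12) p.264, (6.20) p.282] -/
theorem comp_cos_even (H : ℂ → ℂ) (z : ℂ) : H (Complex.cos (-z)) = H (Complex.cos z) := by
  rw [Complex.cos_neg]

/-- Conversely `H ∘ cos` is `2π`-periodic ((2.11)). [cite: MullerSchiemann1987, (2.11) p.264, (6.20) p.282] -/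
theorem comp_cos_periodic (H : ℂ → ℂ) : Function.Periodic (fun z => H (Complex.cos z)) (2 * (Real.pi : ℂ)) :=
  fun z => by simp only [Complex.cos_add_two_pi]

/-- **«cos mz is a polynomial in w = cos z»**: `cos(mz) = T_m(cos z)` (Mathlib's Chebyshev `T_complex_cos`), so a
partial Fourier sum `Σ_{m<M} a_m cos(mz)` is the polynomial `Σ_{m<M} a_m T_m` evaluated at `w = cos z`.
[cite: MullerSchiemann1987, p.282 L.35–37] -/
theorem fourierPartialSum_eq_chebyshev_eval (a : ℕ → ℂ) (M : ℕ) (z : ℂ) :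
    ∑ m ∈ Finset.range M, a m * Complex.cos (m * z) =
      (∑ m ∈ Finset.range M, a m • Polynomial.Chebyshev.T ℂ m).eval (Complex.cos z) := by
  rw [Polynomial.eval_finsetSum]
  refine Finset.sum_congr rfl fun m _ => ?_
  have hT := Polynomial.Chebyshev.T_complex_cos z m
  push_cast at hT
  rw [Polynomial.eval_smul, smul_eq_mul, hT]

/-! ## §4 (6.21): `g̃_H(u, z) := H(u₀ cos z + u₃ sin z)` satisfies (2.8)–(2.10) for any `H` -/

open HeatKernel (u0 u3 diagPhase u0_diagPhase_mul u3_diagPhase_mul u0_one u3_one u0_inv u3_inv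
  u0_sq_add_u3_sq_le_one continuous_u0 continuous_u3)

/-- (2.17)-type identity behind (2.8) for (6.21):
`u₀(e^{−ixσ₃}u) cos z + u₃(e^{−ixσ₃}u) sin z = u₀ cos(x + z) + u₃ sin(x + z)`.
[cite: MullerSchiemann1987, (2.8) p.264, (2.17) p.265, (6.21) p.283] -/
theorem inner_diagPhase_mul (x : ℝ) (U : Matrix.specialUnitaryGroup (Fin 2) ℂ) (z : ℂ) :
    (u0 (diagPhase x * U) : ℂ) * Complex.cos z + (u3 (diagPhase x * U) : ℂ) * Complex.sin z =
      (u0 U : ℂ) * Complex.cos ((x : ℂ) + z) + (u3 U : ℂ) * Complex.sin ((x : ℂ) + z) := by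
  rw [u0_diagPhase_mul, u3_diagPhase_mul, Complex.cos_add, Complex.sin_add, ← Complex.ofReal_cos,
    ← Complex.ofReal_sin]
  push_cast
  ring

/-- **(6.21) satisfies (2.8)**: `g̃_H(e^{−ixσ₃}u, z) = g̃_H(u, x + z)` for ANY `H : ℂ → ℂ`.
[cite: MullerSchiemann1987, (2.8) p.264, (6.21) p.283] -/
theorem eq621_symm28 (H : ℂ → ℂ) (x : ℝ) (U : Matrix.specialUnitaryGroup (Fin 2) ℂ) (z : ℂ) :
    H ((u0 (diagPhase x * U) : ℂ) * Complex.cos z + (u3 (diagPhase x * U) : ℂ) * Complex.sin z) =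
      H ((u0 U : ℂ) * Complex.cos ((x : ℂ) + z) + (u3 U : ℂ) * Complex.sin ((x : ℂ) + z)) := by
  rw [inner_diagPhase_mul]

/-- (2.9)-identity for (6.21): `u₀(u⁻¹) cos(−z) + u₃(u⁻¹) sin(−z) = u₀ cos z + u₃ sin z`.
[cite: MullerSchiemann1987, (2.9) p.264, (6.21) p.283] -/
theorem inner_inv_neg (U : Matrix.specialUnitaryGroup (Fin 2) ℂ) (z : ℂ) :
    (u0 U⁻¹ : ℂ) * Complex.cos (-z) + (u3 U⁻¹ : ℂ) * Complex.sin (-z) =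
      (u0 U : ℂ) * Complex.cos z + (u3 U : ℂ) * Complex.sin z := by
  rw [u0_inv, u3_inv, Complex.cos_neg, Complex.sin_neg]
  push_cast
  ring

/-- **(6.21) satisfies (2.9)**: `g̃_H(u⁻¹, −z) = g̃_H(u, z)` for any `H`. [cite: MullerSchiemann1987, (2.9) p.264,
(6.21) p.283] -/
theorem eq621_symm29 (H : ℂ → ℂ) (U : Matrix.specialUnitaryGroup (Fin 2) ℂ) (z : ℂ) :
    H ((u0 U⁻¹ : ℂ) * Complex.cos (-z) + (u3 U⁻¹ : ℂ) * Complex.sin (-z)) =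
      H ((u0 U : ℂ) * Complex.cos z + (u3 U : ℂ) * Complex.sin z) := by
  rw [inner_inv_neg]

/-- **(6.21) satisfies (2.10) with (6.20)**: at the unit element `g̃_H(e₀, z) = H(cos z)` (`= h(z)`).
[cite: MullerSchiemann1987, (2.10) p.264, (6.20) p.282, (6.21) p.283] -/
theorem eq621_at_one (H : ℂ → ℂ) (z : ℂ) :
    H ((u0 (1 : Matrix.specialUnitaryGroup (Fin 2) ℂ) : ℂ) * Complex.cos z +
        (u3 (1 : Matrix.specialUnitaryGroup (Fin 2) ℂ) : ℂ) * Complex.sin z) = H (Complex.cos z) := by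
  rw [u0_one, u3_one]
  push_cast
  rw [one_mul, zero_mul, add_zero]

/-- «g^{(−n)}(u) := g̃^{(−n)}(u, 0) = H^{(−n)}(u₀)»: at `z = 0`, `g̃_H(u, 0) = H(u₀)`. [cite: MullerSchiemann1987, p.283
L.4–5] -/
theorem eq621_at_zero (H : ℂ → ℂ) (U : Matrix.specialUnitaryGroup (Fin 2) ℂ) :
    H ((u0 U : ℂ) * Complex.cos 0 + (u3 U : ℂ) * Complex.sin 0) = H (u0 U) := by
  rw [Complex.cos_zero, Complex.sin_zero, mul_one, mul_zero, add_zero]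

/-- For `u ∈ G = SU(2)` and `|Im z| < d`: `u₀ cos z + u₃ sin z ∈ 𝒟(d)` (p.283 L.1, with `u₀² + u₃² ≤ 1` from
`|u₀₀|² ≤ 1`). [cite: MullerSchiemann1987, p.283 L.1] -/
theorem inner_mem_ellipse_SU2 (U : Matrix.specialUnitaryGroup (Fin 2) ℂ) {z : ℂ} {d : ℝ} (hz : |z.im| < d) :
    ((u0 U : ℂ) * Complex.cos z + (u3 U : ℂ) * Complex.sin z).re ^ 2 / Real.cosh d ^ 2 +
        ((u0 U : ℂ) * Complex.cos z + (u3 U : ℂ) * Complex.sin z).im ^ 2 / Real.sinh d ^ 2 < 1 :=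
  inner_mem_ellipse (u0_sq_add_u3_sq_le_one U) hz

/-- **(6.21) is «holomorphic in z»** on the strip `|Im z| < d` whenever `H` is holomorphic on `𝒟(d)`.
[cite: MullerSchiemann1987, (6.21) p.283 L.2–3] -/
theorem differentiableOn_eq621 {H : ℂ → ℂ} {d : ℝ}
    (hH : DifferentiableOn ℂ H {w : ℂ | w.re ^ 2 / Real.cosh d ^ 2 + w.im ^ 2 / Real.sinh d ^ 2 < 1})
    (U : Matrix.specialUnitaryGroup (Fin 2) ℂ) :
    DifferentiableOn ℂ (fun z : ℂ => H ((u0 U : ℂ) * Complex.cos z + (u3 U : ℂ) * Complex.sin z))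
      {z : ℂ | |z.im| < d} := by
  refine hH.comp ?_ fun z hz => ?_
  · exact ((Complex.differentiable_cos.const_mul _).add (Complex.differentiable_sin.const_mul _)).differentiableOn
  · exact inner_mem_ellipse_SU2 U hz

/-- **(6.21) is «continuous in u ∈ G and … in z»**: jointly continuous on `G × {|Im z| < d}` whenever `H` is
continuous on `𝒟(d)`. [cite: MullerSchiemann1987, (6.21) p.283 L.2–3] -/
theorem continuousOn_eq621 {H : ℂ → ℂ} {d : ℝ}
    (hH : ContinuousOn H {w : ℂ | w.re ^ 2 / Real.cosh d ^ 2 + w.im ^ 2 / Real.sinh d ^ 2 < 1}) :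
    ContinuousOn
      (fun p : Matrix.specialUnitaryGroup (Fin 2) ℂ × ℂ =>
        H ((u0 p.1 : ℂ) * Complex.cos p.2 + (u3 p.1 : ℂ) * Complex.sin p.2))
      {p | |p.2.im| < d} := by
  refine hH.comp ?_ fun p hp => ?_
  · exact (((Complex.continuous_ofReal.comp (continuous_u0.comp continuous_fst)).mul
      (Complex.continuous_cos.comp continuous_snd)).add
      ((Complex.continuous_ofReal.comp (continuous_u3.comp continuous_fst)).mul
      (Complex.continuous_sin.comp continuous_snd))).continuousOn
  · exact inner_mem_ellipse_SU2 p.1 hp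

open Literature.Analysis.Complex (isOpen_setOf_abs_im_lt eqOn_setOf_abs_im_lt_of_forall_ofReal)

/-! ## §5 (v1.1) The ANALYTIC content of (6.20): `H` is holomorphic on `𝒟(d)`

*«… this series defines a holomorphic function H^{(−n)}(w) on 𝒟_n … satisfying there h^{(−n)}(z) = H^{(−n)}(cos z)»*
(p.282). The paper argues through the Fourier–Chebyshev series; here the SAME conclusion is reached by the classical
route (a genuinely shorter road in Mathlib): `cos` is an open map (open mapping theorem), so `H` is continuous on
`𝒟(d)`; at a non-critical value `w = cos z₀`, `sin z₀ ≠ 0`, `H = h ∘ cos⁻¹_loc` is holomorphic (inverse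
function theorem); the critical values `±1` are removable singularities (Riemann). -/

/-- `cos : ℂ → ℂ` is an open map (open mapping theorem; `cos 0 = 1 ≠ −1 = cos π`). [cite: MullerSchiemann1987, (6.20)
p.282] -/
theorem isOpenMap_cos : IsOpenMap Complex.cos := by
  rcases (Complex.differentiable_cos.differentiableOn.analyticOnNhd isOpen_univ).is_constant_or_isOpenMap with
    ⟨w, hw⟩ | h
  · exfalso
    have h0 := hw 0
    have hπ := hw (Real.pi : ℂ)
    rw [Complex.cos_zero] at h0
    rw [Complex.cos_pi, ← h0] at hπ
    norm_num at hπ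
  · exact h

/-- `sin z = 0 ⟹ cos z = ±1`: the critical values of `cos` are `±1`. [cite: MullerSchiemann1987, (6.20) p.282] -/
theorem cos_eq_one_or_neg_one_of_sin_eq_zero {z : ℂ} (hs : Complex.sin z = 0) :
    Complex.cos z = 1 ∨ Complex.cos z = -1 := by
  have h := Complex.sin_sq_add_cos_sq z
  rw [hs, zero_pow two_ne_zero, zero_add, sq_eq_one_iff] at h
  exact h

/-- If `h = H ∘ cos` with `h` continuous on an open set `S ∋ z₀`, then `H` is continuous at `cos z₀` (`cos` being
open). [cite: MullerSchiemann1987, (6.20) p.282] -/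
theorem continuousAt_factor {h H : ℂ → ℂ} {S : Set ℂ} (hS : IsOpen S) (hh : ContinuousOn h S)
    (hH : ∀ z, h z = H (Complex.cos z)) {z₀ : ℂ} (hz₀ : z₀ ∈ S) : ContinuousAt H (Complex.cos z₀) := by
  rw [ContinuousAt, tendsto_nhds]
  intro V hV hV0
  have hO : IsOpen (S ∩ h ⁻¹' V) := hh.isOpen_inter_preimage hS hV
  have hz₀O : z₀ ∈ S ∩ h ⁻¹' V := ⟨hz₀, by rw [Set.mem_preimage, hH z₀]; exact hV0⟩
  refine Filter.mem_of_superset ((isOpenMap_cos _ hO).mem_nhds ⟨z₀, hz₀O, rfl⟩) ?_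
  rintro w ⟨z, hz, rfl⟩
  rw [Set.mem_preimage, ← hH z]
  exact hz.2

/-- If `h = H ∘ cos` with `h` holomorphic on an open set `S ∋ z₀` and `sin z₀ ≠ 0`, then `H` is complex-differentiable
at `cos z₀`: near `cos z₀`, `H = h ∘ g` for the local inverse `g` of `cos` at `z₀` (inverse function theorem).
[cite: MullerSchiemann1987, (6.20) p.282] -/
theorem differentiableAt_factor {h H : ℂ → ℂ} {S : Set ℂ} (hS : IsOpen S) (hh : DifferentiableOn ℂ h S)
    (hH : ∀ z, h z = H (Complex.cos z)) {z₀ : ℂ} (hz₀ : z₀ ∈ S) (hsin : Complex.sin z₀ ≠ 0) :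
    DifferentiableAt ℂ H (Complex.cos z₀) := by
  have hc : HasStrictDerivAt Complex.cos (-Complex.sin z₀) z₀ := Complex.hasStrictDerivAt_cos z₀
  have hne : -Complex.sin z₀ ≠ 0 := neg_ne_zero.mpr hsin
  have hg_diff : DifferentiableAt ℂ (hc.localInverse Complex.cos _ _ hne) (Complex.cos z₀) :=
    (hc.to_localInverse hne).hasDerivAt.differentiableAt
  have hg0 : hc.localInverse Complex.cos _ _ hne (Complex.cos z₀) = z₀ := (hc.eventually_left_inverse hne).self_of_nhds
  have heq : H =ᶠ[nhds (Complex.cos z₀)] fun w => h (hc.localInverse Complex.cos _ _ hne w) :=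
    (hc.eventually_right_inverse hne).mono fun w hw => by
      show H w = h (hc.localInverse Complex.cos _ _ hne w)
      rw [hH, hw]
  have hh0 : DifferentiableAt ℂ h (hc.localInverse Complex.cos _ _ hne (Complex.cos z₀)) := by
    rw [hg0]; exact hh.differentiableAt (hS.mem_nhds hz₀)
  exact (hh0.comp _ hg_diff).congr_of_eventuallyEq heq

/-- The ellipse interior `𝒟(d)` is open. [cite: MullerSchiemann1987, (6.20) p.282] -/
theorem isOpen_ellipse (d : ℝ) :
    IsOpen {w : ℂ | w.re ^ 2 / Real.cosh d ^ 2 + w.im ^ 2 / Real.sinh d ^ 2 < 1} :=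
  isOpen_lt (((Complex.continuous_re.pow 2).div_const _).add ((Complex.continuous_im.pow 2).div_const _))
    continuous_const

/-- If `h = H ∘ cos` with `h` continuous on the strip `{|Im z| < d}`, `d > 0`, then `H` is continuous on `𝒟(d)`.
[cite: MullerSchiemann1987, (6.20) p.282] -/
theorem continuousOn_factor {d : ℝ} (hd : 0 < d) {h H : ℂ → ℂ} (hh : ContinuousOn h {z : ℂ | |z.im| < d})
    (hH : ∀ z, h z = H (Complex.cos z)) :
    ContinuousOn H {w : ℂ | w.re ^ 2 / Real.cosh d ^ 2 + w.im ^ 2 / Real.sinh d ^ 2 < 1} := by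
  intro w hw
  obtain ⟨z, hz, rfl⟩ := exists_cos_eq_of_mem_ellipse hd hw
  exact (continuousAt_factor (isOpen_setOf_abs_im_lt d) hh hH hz).continuousWithinAt

/-- **(6.20), the analytic content: `H` is holomorphic on `𝒟(d)`.** If `h = H ∘ cos` with `h` holomorphic on the
strip `{|Im z| < d}`, `d > 0`, then `H` is holomorphic on `𝒟(d) = cos({|Im z| < d})`: at non-critical values by the
inverse function theorem, at the critical values `±1` by Riemann's removable-singularity theorem (continuity from
the open mapping theorem). [cite: MullerSchiemann1987, (6.20) p.282] -/
theorem differentiableOn_factor {d : ℝ} (hd : 0 < d) {h H : ℂ → ℂ}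
    (hh : DifferentiableOn ℂ h {z : ℂ | |z.im| < d}) (hH : ∀ z, h z = H (Complex.cos z)) :
    DifferentiableOn ℂ H {w : ℂ | w.re ^ 2 / Real.cosh d ^ 2 + w.im ^ 2 / Real.sinh d ^ 2 < 1} := by
  set D := {w : ℂ | w.re ^ 2 / Real.cosh d ^ 2 + w.im ^ 2 / Real.sinh d ^ 2 < 1} with hD
  have hDo : IsOpen D := isOpen_ellipse d
  -- non-critical values
  have key : ∀ w ∈ D, w ≠ 1 → w ≠ -1 → DifferentiableAt ℂ H w := by
    intro w hw h1 h2
    obtain ⟨z, hz, rfl⟩ := exists_cos_eq_of_mem_ellipse hd hw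
    refine differentiableAt_factor (isOpen_setOf_abs_im_lt d) hh hH hz fun hs => ?_
    rcases cos_eq_one_or_neg_one_of_sin_eq_zero hs with h | h
    · exact h1 h
    · exact h2 h
  -- continuity everywhere on `D`
  have hcont : ∀ w ∈ D, ContinuousAt H w := by
    intro w hw
    obtain ⟨z, hz, rfl⟩ := exists_cos_eq_of_mem_ellipse hd hw
    exact continuousAt_factor (isOpen_setOf_abs_im_lt d) hh.continuousOn hH hz
  -- removable singularity at a critical value `c ∈ {1, −1}`, using the neighbourhood `D ∖ {−c}`
  have crit : ∀ c ∈ D, (∀ v ∈ D, v ≠ c → v ≠ -c → DifferentiableAt ℂ H v) → -c ≠ c →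
      DifferentiableAt ℂ H c := by
    intro c hc hvd hneg
    have hs : D \ {-c} ∈ nhds c :=
      (hDo.sdiff isClosed_singleton).mem_nhds ⟨hc, fun h => hneg (Set.mem_singleton_iff.mp h).symm⟩
    have hdiff : DifferentiableOn ℂ H ((D \ {-c}) \ {c}) := fun v hv =>
      (hvd v hv.1.1 (fun h => hv.2 (Set.mem_singleton_iff.mpr h))
        (fun h => hv.1.2 (Set.mem_singleton_iff.mpr h))).differentiableWithinAt
    have hD' := (Complex.differentiableOn_compl_singleton_and_continuousAt_iff hs).mp ⟨hdiff, hcont c hc⟩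
    exact hD'.differentiableAt hs
  intro w hw
  refine DifferentiableAt.differentiableWithinAt ?_
  by_cases h1 : w = 1
  · subst h1
    exact crit 1 hw (fun v hv hv1 hv2 => key v hv hv1 hv2) (by norm_num)
  by_cases h2 : w = -1
  · subst h2
    exact crit (-1) hw (fun v hv hv1 hv2 => key v hv (by rwa [neg_neg] at hv2) hv1) (by norm_num)
  exact key w hw h1 h2

/-- **(6.20)**: an even, `2π`-periodic `h` holomorphic on the strip `{|Im z| < d}` (`d > 0`) is `h(z) = H(cos z)` for a
(unique) `H` HOLOMORPHIC on `𝒟(d)`. [cite: MullerSchiemann1987, (6.20) p.282] -/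
theorem eq620 {d : ℝ} (hd : 0 < d) {h : ℂ → ℂ} (hh : DifferentiableOn ℂ h {z : ℂ | |z.im| < d})
    (he : ∀ z, h (-z) = h z) (hp : Function.Periodic h (2 * (Real.pi : ℂ))) :
    ∃ H : ℂ → ℂ, DifferentiableOn ℂ H {w : ℂ | w.re ^ 2 / Real.cosh d ^ 2 + w.im ^ 2 / Real.sinh d ^ 2 < 1} ∧
      ∀ z, h z = H (Complex.cos z) := by
  obtain ⟨H, hH⟩ := exists_factor_cos he hp
  exact ⟨H, differentiableOn_factor hd hh hH, hH⟩

/-- **(6.20)–(6.21) assembled**: for an even, `2π`-periodic `h` holomorphic on `{|Im z| < d}` (`d > 0`) there is `H`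
holomorphic on `𝒟(d)` with `h = H ∘ cos`, and `g̃_H(u, z) = H(u₀ cos z + u₃ sin z)` is holomorphic in `z` on the strip
for every `u ∈ G`, with `g̃_H(e₀, z) = h(z)` ((2.10)); (2.8)–(2.9) hold by `eq621_symm28` / `eq621_symm29`.
[cite: MullerSchiemann1987, (6.20) p.282, (6.21) p.283] -/
theorem eq621 {d : ℝ} (hd : 0 < d) {h : ℂ → ℂ} (hh : DifferentiableOn ℂ h {z : ℂ | |z.im| < d})
    (he : ∀ z, h (-z) = h z) (hp : Function.Periodic h (2 * (Real.pi : ℂ))) :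
    ∃ H : ℂ → ℂ, DifferentiableOn ℂ H {w : ℂ | w.re ^ 2 / Real.cosh d ^ 2 + w.im ^ 2 / Real.sinh d ^ 2 < 1} ∧
      (∀ z, h z = H (Complex.cos z)) ∧
      (∀ U : Matrix.specialUnitaryGroup (Fin 2) ℂ,
        DifferentiableOn ℂ (fun z : ℂ => H ((u0 U : ℂ) * Complex.cos z + (u3 U : ℂ) * Complex.sin z))
          {z : ℂ | |z.im| < d}) ∧
      ∀ z, H ((u0 (1 : Matrix.specialUnitaryGroup (Fin 2) ℂ) : ℂ) * Complex.cos z +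
        (u3 (1 : Matrix.specialUnitaryGroup (Fin 2) ℂ) : ℂ) * Complex.sin z) = h z := by
  obtain ⟨H, hHd, hH⟩ := eq620 hd hh he hp
  exact ⟨H, hHd, hH, fun U => differentiableOn_eq621 hHd U, fun z => by rw [eq621_at_one H z, ← hH z]⟩

/-! ## §6 (v1.1) «Equation (6.21) is the unique "analytic continuation," (2.7), of g(u) := g̃(u, 0) = H(u₀)»

A family `G̃(u, ·)` holomorphic on the strip with the symmetry (2.8) is determined by its values at `z = 0`: for real
`x`, `G̃(u, x) = G̃(e^{−ixσ₃}u, 0) = H(u₀(e^{−ixσ₃}u)) = H(u₀ cos x + u₃ sin x)` by (2.17), and two functions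
holomorphic on the strip that agree on the real axis agree on the strip (identity theorem on the strip from the real
axis — the tree's `Literature.Analysis.Complex.eqOn_setOf_abs_im_lt_of_forall_ofReal`). -/

/-- **«(6.21) is the unique "analytic continuation," (2.7), of g(u) := g̃(u, 0) = H(u₀)»**: if `G̃(u, ·)` is holomorphic
on the strip `{|Im z| < d}` for every `u ∈ G`, has the symmetry (2.8) `G̃(e^{−ixσ₃}u, z) = G̃(u, x + z)`, and
`G̃(u, 0) = H(u₀)` with `H` holomorphic on `𝒟(d)`, then `G̃(u, z) = H(u₀ cos z + u₃ sin z)` on the strip.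
[cite: MullerSchiemann1987, (2.7)–(2.8) p.264, (2.17) p.265, (6.21) p.283] -/
theorem eq621_unique {d : ℝ} (hd : 0 < d) {H : ℂ → ℂ}
    (hH : DifferentiableOn ℂ H {w : ℂ | w.re ^ 2 / Real.cosh d ^ 2 + w.im ^ 2 / Real.sinh d ^ 2 < 1})
    {Gt : Matrix.specialUnitaryGroup (Fin 2) ℂ → ℂ → ℂ}
    (hG : ∀ U, DifferentiableOn ℂ (Gt U) {z : ℂ | |z.im| < d})
    (h28 : ∀ (x : ℝ) (U : Matrix.specialUnitaryGroup (Fin 2) ℂ) (z : ℂ), Gt (diagPhase x * U) z = Gt U ((x : ℂ) + z))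
    (h0 : ∀ U, Gt U 0 = H (u0 U)) (U : Matrix.specialUnitaryGroup (Fin 2) ℂ) :
    Set.EqOn (Gt U) (fun z : ℂ => H ((u0 U : ℂ) * Complex.cos z + (u3 U : ℂ) * Complex.sin z))
      {z : ℂ | |z.im| < d} := by
  refine eqOn_setOf_abs_im_lt_of_forall_ofReal hd (hG U) (differentiableOn_eq621 hH U) fun x => ?_
  have h1 : Gt U (x : ℂ) = Gt (diagPhase x * U) 0 := by rw [h28, add_zero]
  show Gt U (x : ℂ) = H ((u0 U : ℂ) * Complex.cos x + (u3 U : ℂ) * Complex.sin x)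
  rw [h1, h0, u0_diagPhase_mul]
  congr 1
  push_cast
  ring

end Theorem3Continuation

end MullerSchiemann1987

end Literature.MathematicalPhysics.QuantumFieldTheory
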